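import Mathlib
import Summits.QuantumFields.YangMills.Theorems.CurvatureSandwichBound.Negative.Unbundled
import Summits.QuantumFields.YangMills.Theorems.IsotropyFromPowerCountingCurvatureSandwichBoundChainEngine
import Summits.QuantumFields.YangMills.Theorems.MirrorModularBoostsPlanarSpectralConeDensityHelpers
import Summits.QuantumFields.YangMills.Theorems.MirrorModularBoostsSoftKernelBoostCovarianceDiagCorePeel
import Summits.QuantumFields.YangMills.Theorems.MirrorModularBoostsSoftKernelBoostCovarianceInsertionOps
import HarnessLib

/-!
# `CurvatureSandwichBound` (Σ), line `Sketch`: stub `stub_generalWindow` — general windows from the axis row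

Support file for crux stmt-QuantumFields-18372 (`IsotropyFromPowerCounting.CurvatureSandwichBound`), registered
skeleton `Cruxes/CurvatureSandwichBound/Lines/Sketch.lean` (v4), wave-2 model-blind stub (GW).

Fix a one-species family `S` on `ℝ⁴` with an `e₀`-reconstruction `h : OSReconstructionNoE1 S.toLabelled` and
the AXIS sandwich row `SandwichBound S h μ C` (insertions `f₁ = g ⊗ hh` windowed in `[u, 2u]` in front of
states at `2u + v`, `0 < u, v ≤ 1`, cost `C·Mg·(Mh+Mh')·(u^{-μ} + v^{-μ})`).  CLAIM (`stub_generalWindow`):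
for `0 ≤ μ ≤ 4`, `0 ≤ C`, EVERY window `[a, a+ℓ]` (`0 < a ≤ 1`, `ℓ ≥ 0`) and every right gap `0 < γ ≤ 1` the
insertion in front of a state at time `a + ℓ + γ` costs at most `64·C·Mg·(Mh+Mh')·(a^{-μ} + γ^{-μ})`.

PROOF (pure Osterwalder–Schrader bookkeeping over the OS space, no model input).
* `GeneralWindow.exists_pou`: a smooth partition of unity of `[a, a+ℓ]` in time by telescoping smooth steps
  (`Real.smoothTransition`), spacing `a/4`, pieces compactly supported in intervals of length `a/2`, values in
  `[0, 1]`.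
* The pieces `F_k = χ_k(x⁰)·f₁` are Schwartz (`SchwartzMap.smulLeftCLM` by a compactly supported smooth
  function of the time coordinate, `HasCompactSupport.hasTemperateGrowth`), of product form `(χ_k g) ⊗ hh`
  with `χ_k g` living in `[c_k, d_k]`, `a ≤ d_k ≤ a + ℓ`, `d_k ≤ 2c_k`, `d_k ≤ c_k + 1`, and
  `Σ_k ∫|χ_k g| = ∫|g|`; they sum to `f₁`.
* `GeneralWindow.piece_bound`: one piece costs `C·∫|χ_k g|·(Mh+Mh')·(16 a^{-μ} + γ^{-μ})` — translate the
  head back by `θ = d − 2u`, `u = min(d/2, 1) ≥ a/2`, so that it sits in `[u, 2u]`, absorb the surplus gap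
  into the state (`v = min(a+ℓ+γ−d, 1) ≥ γ`), both moves being contractions `e^{-tH}`
  (`DiagPeel.norm_fieldVec_translate_le`: `transfer_fieldVec`, `norm_transfer_le`), and apply the row at
  `(u, v)`; `(a/2)^{-μ} ≤ 16 a^{-μ}`.
* Sum: `Ψ` is additive (`Density.fieldVec_add`, here `GeneralWindow.fieldVec_sum`), triangle inequality,
  `16 ≤ 64`.

References: K. Osterwalder, R. Schrader, Comm. Math. Phys. 31 (1973) §4.1 (4.6), (4.9); J. Glimm, A. Jaffe,
*Quantum Physics* (2nd ed. 1987) §6.1 Thm 6.1.3, §10.5 (multiple reflections).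
-/

noncomputable section

namespace Summit.QuantumFields.YangMills.Theorems.CurvatureSandwichBound.Sketch

open scoped BigOperators SchwartzMap InnerProductSpace ContDiff
open MeasureTheory Filter Topology
open Literature.MathematicalPhysics.QuantumLattice Literature.MathematicalPhysics.AQFT
  Literature.MathematicalPhysics.QuantumFieldTheory Literature.Probability.LatticeModels
open Summit.QuantumFields.YangMills.Theorems.NPointIsotropy.Negative (E4)
open Summit.QuantumFields.YangMills.Theorems.CurvatureSandwichBound.Negative (SandwichBound)
open Summit.QuantumFields.YangMills.Cruxes.PlanarSpectralCone.PositivityDiscToOperatorCone.Density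
  (isTimeOrdered_add fieldVec_add fieldVec_congr fieldVec_zero)
open Summit.QuantumFields.YangMills.Theorems.SoftKernelBoostCovariance.Sketch (isTimeOrdered_zero')
open Summit.QuantumFields.YangMills.Theorems.SoftKernelBoostCovariance.Sketch.DiagPeel
  (isTimeOrdered_head_tail translate_productForm integrable_shift integral_norm_shift norm_fieldVec_translate_le)

namespace GeneralWindow

/-- **Smooth partition of unity of an interval by telescoping smooth steps.**  For `δ > 0` the functions
`χ_k(t) = σ((t−a)/δ + 1 − k) − σ((t−a)/δ − k)` (`σ = Real.smoothTransition`, `k < K`,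
`K = ⌈(L−a)/δ⌉₊ + 1`) are smooth, compactly supported in `[a + (k−1)δ, a + (k+1)δ]`, take values in
`[0, 1]` and sum to `1` on `[a, L]`. -/
theorem exists_pou (a L δ : ℝ) (hδ : 0 < δ) :
    ∃ (K : ℕ) (χ : ℕ → ℝ → ℝ), (∀ k, ContDiff ℝ ∞ (χ k)) ∧ (∀ k, HasCompactSupport (χ k)) ∧
      (∀ k t, 0 ≤ χ k t) ∧ (∀ k t, χ k t ≤ 1) ∧
      (∀ t, a ≤ t → t ≤ L → ∑ k ∈ Finset.range K, χ k t = 1) ∧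
      ∀ k t, χ k t ≠ 0 → a + ((k : ℝ) - 1) * δ ≤ t ∧ t ≤ a + ((k : ℝ) + 1) * δ := by
  -- the smooth steps `ψ k t = σ((t - a)/δ + 1 - k)`
  set ψ : ℕ → ℝ → ℝ := fun k t => Real.smoothTransition ((t - a) / δ + 1 - k) with hψ
  have hψd : ∀ k, ContDiff ℝ ∞ (ψ k) := fun k =>
    Real.smoothTransition.contDiff.comp
      (((contDiff_id.sub contDiff_const).div_const δ |>.add contDiff_const).sub contDiff_const)
  have hψmono : ∀ k t, ψ (k + 1) t ≤ ψ k t := fun k t =>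
    Real.smoothTransition.monotone (by push_cast; linarith)
  -- `χ k = ψ k − ψ (k+1)` vanishes off `[a + (k-1)δ, a + (k+1)δ]`
  have hvan : ∀ (k : ℕ) (t : ℝ), ¬(a + ((k : ℝ) - 1) * δ ≤ t ∧ t ≤ a + ((k : ℝ) + 1) * δ) →
      ψ k t - ψ (k + 1) t = 0 := by
    intro k t ht
    rcases not_and_or.1 ht with h1 | h2
    · have h1' : (t - a) / δ < (k : ℝ) - 1 := by
        rw [div_lt_iff₀ hδ]; linarith
      simp only [hψ]
      rw [Real.smoothTransition.zero_of_nonpos (by linarith),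
        Real.smoothTransition.zero_of_nonpos (by push_cast; linarith), sub_zero]
    · have h2' : (k : ℝ) + 1 < (t - a) / δ := by
        rw [lt_div_iff₀ hδ]; linarith
      simp only [hψ]
      rw [Real.smoothTransition.one_of_one_le (by linarith),
        Real.smoothTransition.one_of_one_le (by push_cast; linarith), sub_self]
  refine ⟨⌈(L - a) / δ⌉₊ + 1, fun k t => ψ k t - ψ (k + 1) t, fun k => (hψd k).sub (hψd (k + 1)),
    fun k => HasCompactSupport.intro isCompact_Icc fun t ht => hvan k t fun h' => ht ⟨h'.1, h'.2⟩,
    fun k t => sub_nonneg.2 (hψmono k t), fun k t => ?_, fun t hat htL => ?_,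
    fun k t hkt => not_not.1 fun hcon => hkt (hvan k t hcon)⟩
  · -- `≤ 1`
    have := Real.smoothTransition.le_one ((t - a) / δ + 1 - k)
    have := Real.smoothTransition.nonneg ((t - a) / δ + 1 - (k + 1 : ℕ))
    simp only [hψ]
    linarith
  · -- sum to one on `[a, L]` (telescoping)
    rw [Finset.sum_range_sub']
    have h0 : ψ 0 t = 1 := by
      simp only [hψ, Nat.cast_zero, sub_zero]
      exact Real.smoothTransition.one_of_one_le (by
        have : 0 ≤ (t - a) / δ := div_nonneg (by linarith) hδ.le
        linarith)
    have hK : ψ (⌈(L - a) / δ⌉₊ + 1) t = 0 := by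
      simp only [hψ]
      refine Real.smoothTransition.zero_of_nonpos ?_
      have h1 : (t - a) / δ ≤ (L - a) / δ := div_le_div_of_nonneg_right (by linarith) hδ.le
      have h2 : (L - a) / δ ≤ (⌈(L - a) / δ⌉₊ : ℝ) := Nat.le_ceil _
      push_cast
      linarith
    rw [h0, hK, sub_zero]

variable {S : SchwingerFamily E4}

/-- Finite sums of time-ordered test functions are time-ordered. -/
theorem isTimeOrdered_sum {ι : Type*} {n : ℕ} (s : Finset ι) (F : ι → 𝓢((Fin n → E4), ℂ))
    (hF : ∀ i, IsTimeOrdered (F i)) : IsTimeOrdered (∑ i ∈ s, F i) := by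
  classical
  induction s using Finset.induction_on with
  | empty => simpa using (isTimeOrdered_zero' (n := n))
  | insert a s has ih =>
    rw [Finset.sum_insert has]
    exact isTimeOrdered_add (hF a) ih

/-- **`Ψ` is additive over finite sums**: `Ψ_{Σ Fᵢ} = Σ Ψ_{Fᵢ}`. -/
theorem fieldVec_sum (h : OSReconstructionNoE1 S.toLabelled) {ι : Type*} {n : ℕ} (s : Finset ι)
    (F : ι → 𝓢((Fin n → E4), ℂ)) (hF : ∀ i, IsTimeOrdered (F i))
    (hs : IsTimeOrdered (∑ i ∈ s, F i)) :
    h.fieldVec n (fun _ => ()) (∑ i ∈ s, F i) hs = ∑ i ∈ s, h.fieldVec n (fun _ => ()) (F i) (hF i) := by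
  classical
  induction s using Finset.induction_on with
  | empty =>
    rw [fieldVec_congr h Finset.sum_empty hs isTimeOrdered_zero', fieldVec_zero h, Finset.sum_empty]
  | insert a s has ih =>
    rw [fieldVec_congr h (Finset.sum_insert has) hs
        (isTimeOrdered_add (hF a) (isTimeOrdered_sum s F hF)),
      fieldVec_add h (hF a) (isTimeOrdered_sum s F hF), ih, Finset.sum_insert has]

/-- `(min (d/2) 1)^{-μ} ≤ 16 · a^{-μ}` for `0 < a ≤ d`, `a ≤ 1`, `0 ≤ μ ≤ 4`. -/
theorem rpow_head_le {a d μ : ℝ} (ha : 0 < a) (ha1 : a ≤ 1) (had : a ≤ d) (hμ0 : 0 ≤ μ) (hμ4 : μ ≤ 4) :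
    (min (d / 2) 1) ^ (-μ) ≤ 16 * a ^ (-μ) := by
  have h1 : a / 2 ≤ min (d / 2) 1 := le_min (by linarith) (by linarith)
  refine (Real.rpow_le_rpow_of_nonpos (by positivity) h1 (by linarith)).trans ?_
  rw [Real.div_rpow ha.le zero_le_two, Real.rpow_neg zero_le_two, div_inv_eq_mul, mul_comm]
  refine mul_le_mul_of_nonneg_right ?_ (Real.rpow_nonneg ha.le _)
  calc (2 : ℝ) ^ μ ≤ (2 : ℝ) ^ (4 : ℝ) := Real.rpow_le_rpow_of_exponent_le one_le_two hμ4
    _ = 16 := by norm_num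

/-- Congruence of the two translation vectors of a rebuilt piece. -/
theorem piece_congr {m : ℕ} (f : 𝓢((Fin 1 → E4), ℂ)) (W : 𝓢((Fin m → E4), ℂ)) {a₁ b₁ b₂ : E4}
    (h₁ : (0 : E4) = b₁) (h₂ : a₁ = b₂) :
    f.appendTensor (translateMulti a₁ W) = (translateMulti b₁ f).appendTensor (translateMulti b₂ W) := by
  subst h₁ h₂
  rw [translateMulti_zero]

/-- **One windowed piece.**  Under `SandwichBound S h μ C` (`0 ≤ μ ≤ 4`, `0 ≤ C`), a product-form
insertion `f = g ⊗ hh` whose `g` lives in the time window `[c, d]` with `a ≤ d`, `d ≤ 2c`, `d ≤ c + 1`,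
in front of a state at time `τ ≥ d + γ` (`0 < a ≤ 1`, `0 < γ ≤ 1`), satisfies
`‖Ψ_{f ⊗ T_τ W}‖ ≤ C·∫|g|·(Mh+Mh')·(16 a^{-μ} + γ^{-μ})·‖Ψ_W‖`: translate the head back by
`θ = d − 2u`, `u = min(d/2, 1)` (a contraction, `e^{-θH}`), so that it sits in `[u, 2u]`, absorb the
surplus gap `τ − d − v`, `v = min(τ − d, 1)`, into the state (another contraction), and apply the row at
`(u, v)`; finally `u ≥ a/2`, `v ≥ γ`. -/
theorem piece_bound (h : OSReconstructionNoE1 S.toLabelled) {μ C : ℝ} (hμ0 : 0 ≤ μ) (hμ4 : μ ≤ 4)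
    (hC : 0 ≤ C) (hSB : SandwichBound S h μ C) {a γ τ c d : ℝ} (ha : 0 < a) (ha1 : a ≤ 1)
    (hγ : 0 < γ) (hγ1 : γ ≤ 1) (had : a ≤ d) (hdc : d ≤ 2 * c) (hdc1 : d ≤ c + 1) (hdτ : d + γ ≤ τ)
    (f : 𝓢((Fin 1 → E4), ℂ)) (g hh : ℝ × ℝ → ℂ) {Mg Mh Mh' : ℝ}
    (hf : ∀ x : Fin 1 → E4, f x = g (x 0 0, x 0 1) * hh (x 0 2, x 0 3))
    (hg : ∀ p : ℝ × ℝ, g p ≠ 0 → c ≤ p.1 ∧ p.1 ≤ d)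
    (hgi : Integrable g) (hMg : (∫ p, ‖g p‖) ≤ Mg) (hhi : Integrable hh) (hMh : (∫ p, ‖hh p‖) ≤ Mh)
    (hMh' : ∀ p, ‖hh p‖ ≤ Mh') {n : ℕ} (W : 𝓢((Fin n → E4), ℂ)) (hW : IsTimeOrdered W)
    (hFW : IsTimeOrdered (f.appendTensor (translateMulti (τ • EuclideanSpace.single 0 1) W))) :
    ‖h.fieldVec (1 + n) (fun _ => ())
        (f.appendTensor (translateMulti (τ • EuclideanSpace.single 0 1) W)) hFW‖ ≤
      C * Mg * (Mh + Mh') * (16 * a ^ (-μ) + γ ^ (-μ)) * ‖h.fieldVec n (fun _ => ()) W hW‖ := by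
  -- nonnegativity of the masses
  have hMg0 : 0 ≤ Mg := (integral_nonneg fun _ => norm_nonneg _).trans hMg
  have hMh0 : 0 ≤ Mh := (integral_nonneg fun _ => norm_nonneg _).trans hMh
  have hMh'0 : 0 ≤ Mh' := (norm_nonneg _).trans (hMh' 0)
  have hK0 : 0 ≤ C * Mg * (Mh + Mh') := by positivity
  -- the parameters `u = min (d/2) 1`, `v = min (τ - d) 1`
  obtain ⟨u, hudef⟩ : ∃ u : ℝ, u = min (d / 2) 1 := ⟨_, rfl⟩
  obtain ⟨v, hvdef⟩ : ∃ v : ℝ, v = min (τ - d) 1 := ⟨_, rfl⟩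
  have hu : 0 < u := by rw [hudef]; exact lt_min (by linarith) one_pos
  have hu1 : u ≤ 1 := by rw [hudef]; exact min_le_right _ _
  have hud : u ≤ d / 2 := by rw [hudef]; exact min_le_left _ _
  have hv : 0 < v := by rw [hvdef]; exact lt_min (by linarith) one_pos
  have hv1 : v ≤ 1 := by rw [hvdef]; exact min_le_right _ _
  have hvτ : v ≤ τ - d := by rw [hvdef]; exact min_le_left _ _
  -- the back-shift `θ = d - 2u ≥ 0` (with `u ≤ c - θ`) and the surplus gap `s₁ = τ - d - v ≥ 0`
  obtain ⟨θ, hθ⟩ : ∃ θ : ℝ, θ = d - 2 * u := ⟨_, rfl⟩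
  have huc : u ≤ c - θ := by
    rcases le_total (d / 2) 1 with h1 | h1
    · have : u = d / 2 := by rw [hudef]; exact min_eq_left h1
      rw [hθ, this]; linarith
    · have : u = 1 := by rw [hudef]; exact min_eq_right h1
      rw [hθ, this]; linarith
  have hθ0 : 0 ≤ (θ • EuclideanSpace.single 0 1 : E4) 0 := by
    rw [smul_single_apply_zero, hθ]; linarith
  obtain ⟨s₁, hs₁⟩ : ∃ s₁ : ℝ, s₁ = τ - d - v := ⟨_, rfl⟩
  have hs₁0 : 0 ≤ (s₁ • EuclideanSpace.single 0 1 : E4) 0 := by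
    rw [smul_single_apply_zero, hs₁]; linarith
  -- the back-shifted head `f₀ = T_{-θ} f`, windowed in `[u, 2u]`
  obtain ⟨f₀, hf₀def⟩ : ∃ f₀ : 𝓢((Fin 1 → E4), ℂ),
      f₀ = translateMulti ((-θ) • EuclideanSpace.single 0 1) f := ⟨_, rfl⟩
  have hf₀ : ∀ x : Fin 1 → E4, f₀ x = g (x 0 0 - -θ, x 0 1 - 0) * hh (x 0 2, x 0 3) := fun x => by
    rw [hf₀def]
    exact translate_productForm hf _ (smul_single_apply_zero _) (by simp) (by simp) (by simp) x
  have hwin₀ : ∀ p : ℝ × ℝ, g (p.1 - -θ, p.2 - 0) ≠ 0 → u ≤ p.1 ∧ p.1 ≤ 2 * u := by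
    intro p hp
    have := hg _ hp
    simp only at this
    constructor <;> linarith
  have hf₀s := tsupport_subset_window (g := fun p : ℝ × ℝ => g (p.1 - -θ, p.2 - 0)) hf₀ hwin₀
  -- the shifted state `W₁ = T_{s₁} W`; `f₀ ⊗ T_{2u+v} W₁` is time-ordered; the row for the shifted piece
  have hW₁ := OSReconstructionNoE1.isTimeOrdered_translateMulti hW hs₁0
  have hY := isTimeOrdered_head_tail (s := 2 * u + v) f₀ hf₀s hu (by linarith) _ hW₁
  have hSB₀ := hSB u v hu hv hu1 hv1 f₀ (fun p : ℝ × ℝ => g (p.1 - -θ, p.2 - 0)) hh Mg Mh Mh' hf₀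
    hwin₀ (integrable_shift hgi _ _) ((integral_norm_shift g _ _).trans_le hMg) hhi hMh hMh' n _ hW₁ hY
  -- the identity of test functions `f ⊗ T_τ W = T_θ (f₀ ⊗ T_{2u+v} (T_{s₁} W))`
  have hX' := OSReconstructionNoE1.isTimeOrdered_translateMulti hY hθ0
  have idX : f.appendTensor (translateMulti (τ • EuclideanSpace.single 0 1) W) =
      translateMulti (θ • EuclideanSpace.single 0 1)
        (f₀.appendTensor (translateMulti ((2 * u + v) • EuclideanSpace.single 0 1)
          (translateMulti (s₁ • EuclideanSpace.single 0 1) W))) := by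
    simp only [hf₀def, translateMulti_appendTensor, translateMulti_translateMulti]
    refine piece_congr f W ?_ ?_
    · rw [← add_smul, add_neg_cancel, zero_smul]
    · simp only [← add_smul]
      congr 1
      linarith
  -- norms: two contractions and the row
  rw [fieldVec_congr h idX hFW hX']
  have i1 := norm_fieldVec_translate_le h _ hY (θ • EuclideanSpace.single 0 1) hθ0 hX'
  have i2 := norm_fieldVec_translate_le h W hW (s₁ • EuclideanSpace.single 0 1) hs₁0 hW₁
  have hΛ0 : 0 ≤ C * Mg * (Mh + Mh') * (u ^ (-μ) + v ^ (-μ)) :=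
    pairScale_nonneg hC hu hv hMg hMh hMh'
  refine i1.trans (hSB₀.trans ((mul_le_mul_of_nonneg_left i2 hΛ0).trans ?_))
  refine mul_le_mul_of_nonneg_right (mul_le_mul_of_nonneg_left ?_ hK0) (norm_nonneg _)
  have hu' : u ^ (-μ) ≤ 16 * a ^ (-μ) := by rw [hudef]; exact rpow_head_le ha ha1 had hμ0 hμ4
  have hv' : v ^ (-μ) ≤ γ ^ (-μ) := by
    rw [hvdef]; exact Real.rpow_le_rpow_of_nonpos hγ (le_min (by linarith) hγ1) (by linarith)
  exact add_le_add hu' hv'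

end GeneralWindow

open GeneralWindow in
/-- **Stub (GW) — GENERAL WINDOWS from the axis row (model-blind, pure bookkeeping over the OS space).**
If the sandwich bound holds for insertions windowed in `[u, 2u]` in front of states at `2u + v`
(`SandwichBound S h μ C`, `0 ≤ μ ≤ 4`, `0 ≤ C`), then for EVERY window `[a, a + ℓ]` (any length `ℓ ≥ 0`,
left gap `0 < a ≤ 1`) and every right gap `0 < γ ≤ 1` the insertion `f₁ = g ⊗ hh` in front of a state at time
`a + ℓ + γ` is bounded by `64·C·Mg·(Mh+Mh')·(a^{-μ} + γ^{-μ})`: chop `[a, a+ℓ]` by a smooth partition of unity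
in time (`exists_pou`, spacing `a/4`) into finitely many Schwartz pieces `χ_k(x⁰)·f₁` (`SchwartzMap.smulLeftCLM`),
each of product form with `g χ_k` living in a window `[c, d]`, `a ≤ d ≤ a + ℓ`, `d ≤ 2c`, `d − c ≤ 1`, and
`Σ_k ∫|g χ_k| = ∫|g|`; each piece costs `C·∫|gχ_k|·(Mh+Mh')·(16 a^{-μ} + γ^{-μ})` (`piece_bound`); sum by
`Ψ`-additivity (`fieldVec_sum`) and the triangle inequality.  Osterwalder–Schrader 1973 §4.1; Glimm–Jaffe 1987
§6.1, §10.5. -/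
theorem stub_generalWindow :
    ∀ (S : SchwingerFamily E4) (h : OSReconstructionNoE1 S.toLabelled) (μ C : ℝ),
      0 ≤ μ → μ ≤ 4 → 0 ≤ C → SandwichBound S h μ C →
      ∀ (a ℓ γ : ℝ), 0 < a → 0 ≤ ℓ → 0 < γ → a ≤ 1 → γ ≤ 1 →
      ∀ (f₁ : 𝓢((Fin 1 → E4), ℂ)) (g hh : ℝ × ℝ → ℂ) (Mg Mh Mh' : ℝ),
        (∀ x : Fin 1 → E4, f₁ x = g (x 0 0, x 0 1) * hh (x 0 2, x 0 3)) →
        (∀ p : ℝ × ℝ, g p ≠ 0 → a ≤ p.1 ∧ p.1 ≤ a + ℓ) →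
        Integrable g → (∫ p, ‖g p‖) ≤ Mg → Integrable hh → (∫ p, ‖hh p‖) ≤ Mh →
        (∀ p, ‖hh p‖ ≤ Mh') →
      ∀ (n : ℕ) (W : 𝓢((Fin n → E4), ℂ)) (hW : IsTimeOrdered W)
        (hFW : IsTimeOrdered
          (f₁.appendTensor (translateMulti ((a + ℓ + γ) • EuclideanSpace.single 0 1) W))),
        ‖h.fieldVec (1 + n) (fun _ => ())
            (f₁.appendTensor (translateMulti ((a + ℓ + γ) • EuclideanSpace.single 0 1) W)) hFW‖ ≤
          64 * C * Mg * (Mh + Mh') * (a ^ (-μ) + γ ^ (-μ)) * ‖h.fieldVec n (fun _ => ()) W hW‖ := by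
  intro S h μ C hμ0 hμ4 hC hSB a ℓ γ ha hℓ hγ ha1 hγ1 f₁ g hh Mg Mh Mh' hf₁ hg hgi hMg hhi hMh hMh' n W hW
    hFW
  -- nonnegativity of the data
  have hMg0 : 0 ≤ Mg := (integral_nonneg fun _ => norm_nonneg _).trans hMg
  have hMh0 : 0 ≤ Mh := (integral_nonneg fun _ => norm_nonneg _).trans hMh
  have hMh'0 : 0 ≤ Mh' := (norm_nonneg _).trans (hMh' 0)
  have hrpa : 0 ≤ a ^ (-μ) := Real.rpow_nonneg ha.le _
  have hrpγ : 0 ≤ γ ^ (-μ) := Real.rpow_nonneg hγ.le _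
  -- the smooth partition of unity in time, spacing `δ = a/4`; the multipliers have temperate growth
  obtain ⟨K, χ, hχd, hχc, hχ0, hχ1, hχsum, hχsupp⟩ := exists_pou a (a + ℓ) (a / 4) (by positivity)
  have hm : ∀ k, Function.HasTemperateGrowth (fun x : Fin 1 → E4 => χ k (x 0 0)) := fun k =>
    ((hχc k).hasTemperateGrowth (hχd k)).comp (((EuclideanSpace.proj (0 : Fin 4)).comp
      (ContinuousLinearMap.proj (R := ℝ) (φ := fun _ : Fin 1 => E4) (0 : Fin 1))).hasTemperateGrowth)
  -- the pieces `F k = χ_k(x⁰) · f₁`, of product form `g_k ⊗ hh`, `g_k = χ_k g`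
  obtain ⟨F, hFdef⟩ : ∃ F : ℕ → 𝓢((Fin 1 → E4), ℂ),
      ∀ k, F k = SchwartzMap.smulLeftCLM ℂ (fun x : Fin 1 → E4 => χ k (x 0 0)) f₁ := ⟨_, fun _ => rfl⟩
  have hFapply : ∀ k x, F k x = ((χ k (x 0 0) : ℝ) : ℂ) * f₁ x := fun k x => by
    rw [hFdef, SchwartzMap.smulLeftCLM_apply_apply (hm k), Complex.real_smul]
  obtain ⟨gk, hgk⟩ : ∃ gk : ℕ → ℝ × ℝ → ℂ, ∀ k p, gk k p = ((χ k p.1 : ℝ) : ℂ) * g p :=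
    ⟨_, fun _ _ => rfl⟩
  have hFk : ∀ k (x : Fin 1 → E4), F k x = gk k (x 0 0, x 0 1) * hh (x 0 2, x 0 3) := by
    intro k x
    rw [hFapply, hf₁ x, hgk, mul_assoc]
  -- the windows `[c_k, d_k]`, `c_k = max a (a + (k-1)δ)`, `d_k = min (a+ℓ) (a + (k+1)δ)`
  have hwin : ∀ k (p : ℝ × ℝ), gk k p ≠ 0 →
      max a (a + ((k : ℝ) - 1) * (a / 4)) ≤ p.1 ∧ p.1 ≤ min (a + ℓ) (a + ((k : ℝ) + 1) * (a / 4)) := by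
    intro k p hp
    rw [hgk] at hp
    have h1 : χ k p.1 ≠ 0 := fun h0 => hp (by rw [h0, Complex.ofReal_zero, zero_mul])
    have h2 : g p ≠ 0 := fun h0 => hp (by rw [h0, mul_zero])
    exact ⟨max_le (hg p h2).1 (hχsupp k p.1 h1).1, le_min (hg p h2).2 (hχsupp k p.1 h1).2⟩
  -- integrability and masses of the pieces: `Σ_k ∫|g_k| = ∫|g| ≤ Mg`
  have hgki : ∀ k, Integrable (gk k) := fun k => by
    rw [show gk k = fun p => ((χ k p.1 : ℝ) : ℂ) * g p from funext (hgk k)]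
    exact hgi.bdd_mul (c := 1)
      ((Complex.continuous_ofReal.comp ((hχd k).continuous.comp continuous_fst)).aestronglyMeasurable)
      (Filter.Eventually.of_forall fun p => by
        rw [Complex.norm_real, Real.norm_eq_abs, abs_of_nonneg (hχ0 k p.1)]
        exact hχ1 k p.1)
  have hpt : ∀ p : ℝ × ℝ, ∑ k ∈ Finset.range K, ‖gk k p‖ = ‖g p‖ := by
    intro p
    have hnk : ∀ k, ‖gk k p‖ = χ k p.1 * ‖g p‖ := fun k => by
      rw [hgk, norm_mul, Complex.norm_real, Real.norm_eq_abs, abs_of_nonneg (hχ0 k p.1)]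
    simp only [hnk, ← Finset.sum_mul]
    by_cases hp : g p = 0
    · simp [hp]
    · rw [hχsum p.1 (hg p hp).1 (hg p hp).2, one_mul]
  have hmass : ∑ k ∈ Finset.range K, (∫ p : ℝ × ℝ, ‖gk k p‖) ≤ Mg := by
    rw [← integral_finsetSum _ (fun k _ => (hgki k).norm)]
    exact (integral_congr_ae (ae_of_all _ hpt)).trans_le hMg
  -- the pieces sum to `f₁`
  have hsumF : ∑ k ∈ Finset.range K, F k = f₁ := by
    ext x
    rw [sum_apply]
    simp only [hFapply, ← Finset.sum_mul]
    by_cases hx : f₁ x = 0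
    · simp [hx]
    · have h2 : g (x 0 0, x 0 1) ≠ 0 := by
        rw [hf₁ x] at hx
        exact left_ne_zero_of_mul hx
      rw [← Complex.ofReal_sum, hχsum _ (hg _ h2).1 (hg _ h2).2, Complex.ofReal_one, one_mul]
  -- each `F k ⊗ T_τ W` is time-ordered (its support lies in that of `f₁ ⊗ T_τ W`)
  have hXk : ∀ k, IsTimeOrdered
      ((F k).appendTensor (translateMulti ((a + ℓ + γ) • EuclideanSpace.single 0 1) W)) := fun k =>
    (closure_mono fun x hx => by
      rw [Function.mem_support, SchwartzMap.appendTensor_apply] at hx ⊢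
      rw [hFapply] at hx
      exact fun h0 => hx (by rw [mul_assoc, h0, mul_zero])).trans hFW
  -- the piece bounds
  have hpiece : ∀ k, ‖h.fieldVec (1 + n) (fun _ => ())
      ((F k).appendTensor (translateMulti ((a + ℓ + γ) • EuclideanSpace.single 0 1) W)) (hXk k)‖ ≤
      C * (∫ p : ℝ × ℝ, ‖gk k p‖) * (Mh + Mh') * (16 * a ^ (-μ) + γ ^ (-μ)) *
        ‖h.fieldVec n (fun _ => ()) W hW‖ := by
    intro k
    have e1 : a + ((k : ℝ) + 1) * (a / 4) = (a + ((k : ℝ) - 1) * (a / 4)) + a / 2 := by ring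
    have hM : a ≤ max a (a + ((k : ℝ) - 1) * (a / 4)) := le_max_left _ _
    have hM' : a + ((k : ℝ) - 1) * (a / 4) ≤ max a (a + ((k : ℝ) - 1) * (a / 4)) := le_max_right _ _
    have hm1 : min (a + ℓ) (a + ((k : ℝ) + 1) * (a / 4)) ≤ a + ((k : ℝ) + 1) * (a / 4) := min_le_right _ _
    have hm2 : min (a + ℓ) (a + ((k : ℝ) + 1) * (a / 4)) ≤ a + ℓ := min_le_left _ _
    have hm3 : a ≤ min (a + ℓ) (a + ((k : ℝ) + 1) * (a / 4)) :=
      le_min (by linarith) (le_add_of_nonneg_right (by positivity))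
    exact piece_bound h hμ0 hμ4 hC hSB ha ha1 hγ hγ1 hm3 (by linarith) (by linarith) (by linarith)
      (F k) (gk k) hh (hFk k) (hwin k) (hgki k) le_rfl hhi hMh hMh' W hW (hXk k)
  -- sum
  have hXsum : IsTimeOrdered (∑ k ∈ Finset.range K,
      (F k).appendTensor (translateMulti ((a + ℓ + γ) • EuclideanSpace.single 0 1) W)) :=
    isTimeOrdered_sum _ _ hXk
  have idSum : f₁.appendTensor (translateMulti ((a + ℓ + γ) • EuclideanSpace.single 0 1) W) =
      ∑ k ∈ Finset.range K,
        (F k).appendTensor (translateMulti ((a + ℓ + γ) • EuclideanSpace.single 0 1) W) := by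
    rw [← SchwartzMap.appendTensor_sum_left, hsumF]
  rw [fieldVec_congr h idSum hFW hXsum, fieldVec_sum h _ _ hXk hXsum]
  refine (norm_sum_le _ _).trans ((Finset.sum_le_sum fun k _ => hpiece k).trans ?_)
  rw [← Finset.sum_mul, ← Finset.sum_mul, ← Finset.sum_mul, ← Finset.mul_sum]
  have hB : 16 * a ^ (-μ) + γ ^ (-μ) ≤ 64 * (a ^ (-μ) + γ ^ (-μ)) := by linarith
  calc C * (∑ k ∈ Finset.range K, ∫ p : ℝ × ℝ, ‖gk k p‖) * (Mh + Mh') * (16 * a ^ (-μ) + γ ^ (-μ)) *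
        ‖h.fieldVec n (fun _ => ()) W hW‖
      ≤ C * Mg * (Mh + Mh') * (64 * (a ^ (-μ) + γ ^ (-μ))) * ‖h.fieldVec n (fun _ => ()) W hW‖ := by
        gcongr
    _ = 64 * C * Mg * (Mh + Mh') * (a ^ (-μ) + γ ^ (-μ)) * ‖h.fieldVec n (fun _ => ()) W hW‖ := by ring

end Summit.QuantumFields.YangMills.Theorems.CurvatureSandwichBound.Sketch

end
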